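import Mathlib
import Literature.Computability.Complexity.SeparationComplexity
import Literature.Computability.Complexity.SeparationComplexityLP
import Literature.Barriers.PneNP.TSPExtensionComplexityFarkas
import HarnessLib

/-!
# Hrubeš's separation bound holds: `min_{ε>0} rk₊(M(f) - εJ) ≤ 6·(C(f) + n + 1)`

Discharge of the named fact `Literature.Computability.Complexity.hrubes_separation_rank_bound`
(`SeparationComplexity.lean`; P. Hrubeš, *On ε-sensitive monotone computations*, Comput.
Complexity 29 (2020), **Theorem 3** = Theorem 4 + Proposition 7(i)): for every circuit `C` over
the binary basis `B2` computing `f` on `n` inputs there is `ε > 0` and a non-negative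
factorisation `Hamming(x, y) - ε = ∑_{i<r} a_y(i) b_x(i)` on accepted `x` / rejected `y` with
`r ≤ 6 (size C + n + 1)` terms (`hrubes_separation_rank_bound_holds`).

Proof (a direct version of Hrubeš's §3, with Farkas' lemma in place of the compactness Lemma 8
and the pair-extension-complexity Lemma 9 there, which makes the constant explicit). Let `L(x, y)`
be the exact LP of the circuit (`SeparationComplexityLP.lean`): `s ≤ 6·size + 1` inequalities
`c_g · y + e_g(x) ≥ 0`, `e_g` affine in the real input vector `ξ(x)`, feasible exactly over the
accepted Boolean inputs. For an accepted `x` the true gate values give slacks `σ_g(x) ≥ 0`. For a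
rejected `z`, Farkas' lemma (`Literature.Barriers.PneNP.farkas`) gives `λ_z ≥ 0` with
`∑ λ_z c = 0` and `∑_g λ_{z,g} e_g(z) = -1` (`CircuitLP.exists_cert_of_infeasible`), whence the
bilinear identity `∑_g λ_{z,g} σ_g(x) = γ_z · (ξ(x) - ξ(z)) - 1` with `γ_z := ∑_g λ_{z,g} ∇e_g`.
With `M := 1 + ∑_{z,i} |γ_{z,i}|` and `ε := 1/M`, on Boolean points
`M · Hamming(x, z) - γ_z · (ξ(x) - ξ(z)) = ∑_i w_{z,i} [x_i ≠ z_i]` with `w_{z,i} = M ∓ γ_{z,i} ≥ 0`,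
so `Hamming(x, z) - ε = ∑_g (λ_{z,g}/M) σ_g(x) + ∑_i (w_{z,i}/M)([z_i = 0][x_i = 1] + [z_i = 1][x_i = 0])`:
a non-negative factorisation with `s + 2n ≤ 6 (size + n + 1)` terms.

References: [Hrubes2020] Thm. 3, Thm. 4, Prop. 7(i) (crediting Valiant 1977 and Yannakakis 1991
for `sep(f) ≤ O(C(f))`).
-/

namespace Literature.Computability.Complexity

open Finset Matrix GateList CircuitLP

namespace CircuitLP

/-! ### Farkas: an infeasible system of affine inequalities has a normalised certificate -/

/-- **Farkas certificate of infeasibility.** If the system `c_g · y + e_g ≥ 0` (`g ∈ G`) has no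
real solution, then there are multipliers `λ ≥ 0` with `∑ λ_g c_g = 0` and `∑ λ_g e_g = -1`.
(From the conic Farkas alternative `Literature.Barriers.PneNP.farkas` applied in `ℝ^{V ⊕ 1}` to
the generators `(c_g, e_g)` and `(0, 1)` and the target `(0, -1)`.) [folklore] -/
theorem exists_cert_of_infeasible {G V : Type*} [Fintype G] [Fintype V]
    (c : G → V → ℝ) (e : G → ℝ) (h : ¬ ∃ y : V → ℝ, ∀ g, 0 ≤ c g ⬝ᵥ y + e g) :
    ∃ lam : G → ℝ, (∀ g, 0 ≤ lam g) ∧ (∀ v, ∑ g, lam g * c g v = 0) ∧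
      ∑ g, lam g * e g = -1 := by
  classical
  let gen : Option G → V ⊕ Unit → ℝ := fun o =>
    Option.elim o (Sum.elim 0 fun _ => 1) fun g => Sum.elim (c g) fun _ => e g
  let b : V ⊕ Unit → ℝ := Sum.elim 0 fun _ => -1
  rcases Literature.Barriers.PneNP.farkas gen b with ⟨lam, hlam, hb⟩ | ⟨Y, hY, hYb⟩
  · -- alternative (I): read off the two blocks of coordinates
    have hc : ∀ v, ∑ g, lam (some g) * c g v = 0 := fun v => by
      have hv := hb (Sum.inl v)
      rw [Fintype.sum_option] at hv
      simp only [b, gen, Sum.elim_inl, Option.elim_none, Option.elim_some, Pi.zero_apply,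
        mul_zero, zero_add] at hv
      exact hv.symm
    have he : ∑ g, lam (some g) * e g = -1 - lam none := by
      have hv := hb (Sum.inr ())
      rw [Fintype.sum_option] at hv
      simp only [b, gen, Sum.elim_inr, Option.elim_none, Option.elim_some, mul_one] at hv
      linarith
    have hS : 0 < 1 + lam none := by linarith [hlam none]
    refine ⟨fun g => lam (some g) / (1 + lam none), fun g => div_nonneg (hlam _) hS.le,
      fun v => ?_, ?_⟩
    · simp only [div_mul_eq_mul_div, ← Finset.sum_div, hc v, zero_div]
    · simp only [div_mul_eq_mul_div, ← Finset.sum_div, he]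
      rw [div_eq_iff hS.ne']
      ring
  · -- alternative (II): `Y = (y, t)` with `t > 0`, and `y / t` is feasible
    exfalso
    have ht : 0 < Y (Sum.inr ()) := by
      have h1 : b ⬝ᵥ Y = -Y (Sum.inr ()) := by
        simp [b, dotProduct, Fintype.sum_sum_type]
      linarith [h1 ▸ hYb]
    refine h ⟨fun v => Y (Sum.inl v) / Y (Sum.inr ()), fun g => ?_⟩
    have hg : 0 ≤ c g ⬝ᵥ (fun v => Y (Sum.inl v)) + e g * Y (Sum.inr ()) := by
      have h1 := hY (some g)
      simpa [gen, dotProduct, Fintype.sum_sum_type] using h1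
    have h2 : c g ⬝ᵥ (fun v => Y (Sum.inl v) / Y (Sum.inr ())) + e g =
        (c g ⬝ᵥ (fun v => Y (Sum.inl v)) + e g * Y (Sum.inr ())) / Y (Sum.inr ()) := by
      simp only [dotProduct, add_div, Finset.sum_div, mul_div_assoc, mul_div_cancel_right₀ _ ht.ne']
    rw [h2]
    exact div_nonneg hg ht.le

end CircuitLP

/-! ### The certificate of a rejected input and the global normalisation -/

section Main

variable {ι : Type} [Fintype ι] [DecidableEq ι]

/-- On a rejecting input the circuit LP is infeasible, so it has a Farkas certificate:
`λ ≥ 0` with `∑ λ_g c_g = 0` and `∑ λ_g e_g(z) = -1`. [cite: Hrubes2020, Thm. 4 (proof)] -/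
theorem exists_cert_of_eval_false (C : Circuit ι) (z : ι → Bool) (hz : C.eval z = false) :
    ∃ lam : Idx C.gates → ℝ, (∀ g, 0 ≤ lam g) ∧
      (∀ v, ∑ g, lam g * cvec C.gates C.output g v = 0) ∧
      ∑ g, lam g * (ivec C.gates C.output g ⬝ᵥ ξ z + k0 C.gates g) = -1 := by
  refine CircuitLP.exists_cert_of_infeasible _ _ ?_
  rintro ⟨y, hy⟩
  have h := wireOf_eq_true_of_feasible C.gates (wf_gates C) C.output C.wf_output z y
    (fun g => by rw [slack, add_assoc]; exact hy g)
  rw [← circuit_eval, hz] at h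
  exact Bool.false_ne_true h

/-- The Farkas certificate `λ_z` of a rejected input `z` (and `0` on accepted inputs). [cite: Hrubes2020, Thm. 4 (proof)] -/
noncomputable def cert (C : Circuit ι) (z : ι → Bool) : Idx C.gates → ℝ :=
  if hz : C.eval z = false then Classical.choose (exists_cert_of_eval_false C z hz) else 0

/-- The defining properties of the certificate of a rejected input. [cite: Hrubes2020, Thm. 4 (proof)] -/
theorem cert_spec (C : Circuit ι) (z : ι → Bool) (hz : C.eval z = false) :
    (∀ g, 0 ≤ cert C z g) ∧ (∀ v, ∑ g, cert C z g * cvec C.gates C.output g v = 0) ∧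
      ∑ g, cert C z g * (ivec C.gates C.output g ⬝ᵥ ξ z + k0 C.gates g) = -1 := by
  rw [cert, dif_pos hz]
  exact Classical.choose_spec (exists_cert_of_eval_false C z hz)

/-- The certificate is non-negative (on every input). [folklore] -/
theorem cert_nonneg (C : Circuit ι) (z : ι → Bool) (g : Idx C.gates) : 0 ≤ cert C z g := by
  by_cases hz : C.eval z = false
  · exact (cert_spec C z hz).1 g
  · rw [cert, dif_neg hz]; exact le_rfl

/-- The input gradient `γ_z := ∑_g λ_{z,g} ∇e_g` of the certified combination. [cite: Hrubes2020, Thm. 4 (proof)] -/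
noncomputable def gam (C : Circuit ι) (z : ι → Bool) : ι → ℝ :=
  fun i => ∑ g, cert C z g * ivec C.gates C.output g i

/-- The normalising constant `M := 1 + ∑_{z,i} |γ_{z,i}|` (so `ε = 1/M`). [folklore] -/
noncomputable def bigM (C : Circuit ι) : ℝ := 1 + ∑ z : ι → Bool, ∑ i, |gam C z i|

/-- `|γ_{z,i}| ≤ M - 1`. [folklore] -/
theorem abs_gam_le (C : Circuit ι) (z : ι → Bool) (i : ι) : |gam C z i| ≤ bigM C - 1 := by
  rw [bigM, add_sub_cancel_left]
  calc |gam C z i| ≤ ∑ i', |gam C z i'| :=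
        Finset.single_le_sum (f := fun i' => |gam C z i'|) (fun _ _ => abs_nonneg _) (mem_univ i)
    _ ≤ ∑ z' : ι → Bool, ∑ i', |gam C z' i'| :=
        Finset.single_le_sum (f := fun z' : ι → Bool => ∑ i', |gam C z' i'|)
          (fun _ _ => Finset.sum_nonneg fun _ _ => abs_nonneg _) (mem_univ z)

/-- `1 ≤ M`, in particular `M > 0`. [folklore] -/
theorem one_le_bigM (C : Circuit ι) : 1 ≤ bigM C := by
  rw [bigM, le_add_iff_nonneg_right]
  exact Finset.sum_nonneg fun _ _ => Finset.sum_nonneg fun _ _ => abs_nonneg _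

/-- **The bilinear identity.** For an accepted `x` and a rejected `z`:
`∑_g λ_{z,g} σ_g(x) = γ_z · (ξ(x) - ξ(z)) - 1`. [cite: Hrubes2020, Thm. 4 (proof)] -/
theorem sum_cert_mul_slack (C : Circuit ι) (z : ι → Bool) (hz : C.eval z = false)
    (x : ι → Bool) (y : Fin C.gates.length → ℝ) :
    ∑ g, cert C z g * slack C.gates C.output x y g = ∑ i, gam C z i * (ξ x i - ξ z i) - 1 := by
  obtain ⟨-, hc, he⟩ := cert_spec C z hz
  -- the `y`-part vanishes
  have hy : ∑ g, cert C z g * (cvec C.gates C.output g ⬝ᵥ y) = 0 := by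
    calc ∑ g, cert C z g * (cvec C.gates C.output g ⬝ᵥ y)
        = ∑ v, (∑ g, cert C z g * cvec C.gates C.output g v) * y v := by
          simp only [dotProduct, Finset.mul_sum, Finset.sum_mul, mul_assoc]
          exact Finset.sum_comm
      _ = 0 := Finset.sum_eq_zero fun v _ => by rw [hc v, zero_mul]
  -- the input part is `γ_z · ξ`
  have hξ : ∀ w : ι → Bool, ∑ g, cert C z g * (ivec C.gates C.output g ⬝ᵥ ξ w) =
      ∑ i, gam C z i * ξ w i := fun w => by
    simp only [dotProduct, gam, Finset.mul_sum, Finset.sum_mul, mul_assoc]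
    exact Finset.sum_comm
  have he' : ∑ i, gam C z i * ξ z i + ∑ g, cert C z g * k0 C.gates g = -1 := by
    rw [← hξ z, ← Finset.sum_add_distrib]
    simpa only [mul_add] using he
  simp only [slack, mul_add, Finset.sum_add_distrib, hy, hξ x, zero_add, mul_sub,
    Finset.sum_sub_distrib]
  linarith

/-! ### The factorisation -/

/-- Index type of the factorisation: the constraints, and two literal terms per input. [folklore] -/
abbrev FIdx (C : Circuit ι) : Type := Idx C.gates ⊕ (ι ⊕ ι)

/-- Left factors `a_z` (rejected side): `λ_{z,g}/M`; `(M - γ_{z,i})/M` on `[z_i = 0]`;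
`(M + γ_{z,i})/M` on `[z_i = 1]`. [cite: Hrubes2020, Thm. 4 (proof)] -/
noncomputable def afac (C : Circuit ι) (z : ι → Bool) : FIdx C → ℝ
  | .inl g => cert C z g / bigM C
  | .inr (.inl i) => if z i = false then (bigM C - gam C z i) / bigM C else 0
  | .inr (.inr i) => if z i = true then (bigM C + gam C z i) / bigM C else 0

/-- Right factors `b_x` (accepted side): the slacks `σ_g(x)` of the true gate values; `[x_i = 1]`;
`[x_i = 0]`. [cite: Hrubes2020, Thm. 4 (proof)] -/
noncomputable def bfac (C : Circuit ι) (x : ι → Bool) : FIdx C → ℝ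
  | .inl g => if C.eval x = true then slack C.gates C.output x (trueVal C.gates x) g else 0
  | .inr (.inl i) => if x i = true then 1 else 0
  | .inr (.inr i) => if x i = false then 1 else 0

/-- `a_z ≥ 0`. [folklore] -/
theorem afac_nonneg (C : Circuit ι) (z : ι → Bool) (t : FIdx C) : 0 ≤ afac C z t := by
  have hM : 0 < bigM C := lt_of_lt_of_le one_pos (one_le_bigM C)
  have hγ := fun i => abs_le.1 (abs_gam_le C z i)
  rcases t with g | i | i
  · exact div_nonneg (cert_nonneg C z g) hM.le
  · simp only [afac]
    split_ifs
    · exact div_nonneg (by linarith [hγ i |>.2]) hM.le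
    · exact le_rfl
  · simp only [afac]
    split_ifs
    · exact div_nonneg (by linarith [hγ i |>.1]) hM.le
    · exact le_rfl

/-- `b_x ≥ 0` (the true gate values are feasible on an accepted input). [cite: Hrubes2020, Prop. 7(i)] -/
theorem bfac_nonneg (C : Circuit ι) (x : ι → Bool) (t : FIdx C) : 0 ≤ bfac C x t := by
  rcases t with g | i | i
  · simp only [bfac]
    split_ifs with hx
    · rcases g with g | g | g | u
      · exact slack_trueVal_nonneg C.gates (wf_gates C) C.output x _ fun u h => by cases h
      · exact slack_trueVal_nonneg C.gates (wf_gates C) C.output x _ fun u h => by cases h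
      · exact slack_trueVal_nonneg C.gates (wf_gates C) C.output x _ fun u h => by cases h
      · rw [slack_out_trueVal C.gates C.output C.wf_output x u, ← circuit_eval, hx, b2r_true,
          sub_self]
    · exact le_rfl
  · simp only [bfac]; split_ifs <;> norm_num
  · simp only [bfac]; split_ifs <;> norm_num

omit [DecidableEq ι] in
/-- The Hamming distance as a real sum of disagreement indicators. [folklore] -/
theorem hammingDist_eq_sum (x z : ι → Bool) :
    (hammingDist x z : ℝ) = ∑ i, if x i ≠ z i then (1 : ℝ) else 0 := by
  rw [hammingDist, Finset.natCast_card_filter]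

/-- **The factorisation identity**: for accepted `x` and rejected `z`,
`Hamming(x, z) - 1/M = ∑_t a_z(t) b_x(t)`. [cite: Hrubes2020, Thm. 3] -/
theorem sum_afac_mul_bfac (C : Circuit ι) (x z : ι → Bool) (hx : C.eval x = true)
    (hz : C.eval z = false) :
    ∑ t, afac C z t * bfac C x t = (hammingDist x z : ℝ) - 1 / bigM C := by
  have hM : 0 < bigM C := lt_of_lt_of_le one_pos (one_le_bigM C)
  -- the constraint block
  have h1 : ∑ g, afac C z (.inl g) * bfac C x (.inl g) =
      (∑ i, gam C z i * (ξ x i - ξ z i) - 1) / bigM C := by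
    simp only [afac, bfac, hx, ↓reduceIte, div_mul_eq_mul_div, ← Finset.sum_div]
    rw [sum_cert_mul_slack C z hz x]
  -- the literal block, coordinate by coordinate
  have h2 : ∀ i, afac C z (.inr (.inl i)) * bfac C x (.inr (.inl i)) +
      afac C z (.inr (.inr i)) * bfac C x (.inr (.inr i)) =
        (bigM C * (if x i ≠ z i then (1 : ℝ) else 0) - gam C z i * (ξ x i - ξ z i)) / bigM C := by
    intro i
    simp only [afac, bfac, ξ_apply]
    cases x i <;> cases z i <;> simp
  have key : ∀ A H : ℝ, (A - 1 + (bigM C * H - A)) / bigM C = H - 1 / bigM C := fun A H => by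
    rw [show A - 1 + (bigM C * H - A) = bigM C * H - 1 by ring, sub_div,
      mul_div_cancel_left₀ _ hM.ne']
  rw [Fintype.sum_sum_type, h1,
    Fintype.sum_sum_type (f := fun s : ι ⊕ ι => afac C z (Sum.inr s) * bfac C x (Sum.inr s)),
    ← Finset.sum_add_distrib, Finset.sum_congr rfl fun i _ => h2 i, ← Finset.sum_div, ← add_div,
    hammingDist_eq_sum, Finset.sum_sub_distrib, ← Finset.mul_sum]
  exact key _ _

omit [DecidableEq ι] in
/-- The number of terms: `#constraints + 2n ≤ 6 (size + n + 1)` over `B2`. [folklore] -/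
theorem card_fidx_le (C : Circuit ι) (hB : C.IsOver B2) :
    Fintype.card (FIdx C) ≤ 6 * (C.size + Fintype.card ι + 1) := by
  have h := card_idx_le C.gates hB
  simp only [FIdx, Fintype.card_sum, Circuit.size] at h ⊢
  omega

end Main

/-- **Hrubeš 2020, Theorem 3, holds** (with the explicit constant `κ = 6`): for every circuit `C`
over `B2` computing `f` on `n` inputs there are `ε > 0`, `r ≤ 6 (size C + n + 1)` and `a, b ≥ 0`
with `Hamming(x, y) - ε = ∑_{i<r} a_y(i) b_x(i)` for all accepted `x` and rejected `y`; i.e.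
`min_{ε>0} rk₊(M(f) - εJ) ≤ O(C(f) + n)`. [cite: Hrubes2020, Thm. 3] -/
theorem hrubes_separation_rank_bound_holds : hrubes_separation_rank_bound := by
  refine ⟨6, ?_⟩
  intro ι _ _ f C hB hf
  have hM : 0 < bigM C := lt_of_lt_of_le one_pos (one_le_bigM C)
  let e : FIdx C ≃ Fin (Fintype.card (FIdx C)) := Fintype.equivFin _
  refine ⟨1 / bigM C, by positivity, Fintype.card (FIdx C), card_fidx_le C hB,
    fun y i => afac C y (e.symm i), fun x i => bfac C x (e.symm i),
    fun y i => afac_nonneg C y _, fun x i => bfac_nonneg C x _, fun x y hx hy => ?_⟩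
  have hx' : C.eval x = true := (hf x).trans hx
  have hy' : C.eval y = false := (hf y).trans hy
  rw [e.symm.sum_comp (fun t => afac C y t * bfac C x t), sum_afac_mul_bfac C x y hx' hy']

end Literature.Computability.Complexity
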